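import Mathlib
import HarnessLib
import Literature.Geometry.DiscreteGeometry.SphericalCodeHullEulerFormula

/-!
# Soft four-rings, endgame groundwork: the sides and diagonals of a quadrilateral facet

Support file for `SoftFourRings` (route `PricedLinkCensus`, sub-problem `Crystallization`),
endgame groundwork (evidence file §12.8).  For a finite set `X` of unit vectors of `ℝ³` with
`0 ∈ interior (conv X)` and a facet normal `c` with four tight points:

* `quad_facet_structure` : the tight set is enumerated by an injective `p : Fin 4 → ℝ³` such
  that the hull edges inside the facet are exactly the four consecutive pairs
  `{p k, p (k+1)}`, and the two diagonals `{p 0, p 2}`, `{p 1, p 3}` are not hull edges.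
-/

namespace Summit.AtomisticToContinuum.Crystallization.Theorems

open Real RealInnerProductSpace Literature.Geometry.DiscreteGeometry

/-- **Structure of a quadrilateral facet.** -/
theorem quad_facet_structure {X : Finset (EuclideanSpace ℝ (Fin 3))} (hX1 : ∀ y ∈ X, ‖y‖ = 1)
    (h0 : (0 : EuclideanSpace ℝ (Fin 3)) ∈
      interior (convexHull ℝ (X : Set (EuclideanSpace ℝ (Fin 3)))))
    {c : EuclideanSpace ℝ (Fin 3)} (hcF : c ∈ facetNormals X) (h4 : (tightSet X c).card = 4) :
    ∃ p : Fin 4 → EuclideanSpace ℝ (Fin 3), Function.Injective p ∧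
      (∀ k, p k ∈ tightSet X c) ∧ (∀ y ∈ tightSet X c, ∃ k, y = p k) ∧
      edgesOfFacet X c = {{p 0, p 1}, {p 1, p 2}, {p 2, p 3}, {p 3, p 0}} ∧
      ({p 0, p 2} : Finset (EuclideanSpace ℝ (Fin 3))) ∉ hullEdges X ∧
      ({p 1, p 3} : Finset (EuclideanSpace ℝ (Fin 3))) ∉ hullEdges X := by
  classical
  have hc := ne_zero_of_mem_facetNormals hX1 hcF
  set m := (facetAngles X c hc).card with hm
  set w := facetVertex X c hc with hw
  have hm4 : m = 4 := by rw [hm, card_facetAngles hX1 hc, h4]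
  have hinj : ∀ a b, a < m → b < m → w a = w b → a = b := fun a b ha hb hab =>
    facetVertex_injOn hc (Finset.mem_coe.2 (Finset.mem_range.2 ha))
      (Finset.mem_coe.2 (Finset.mem_range.2 hb)) hab
  set p : Fin 4 → EuclideanSpace ℝ (Fin 3) := fun k => w k with hp
  have hpinj : Function.Injective p := by
    intro a b hab
    exact Fin.ext (hinj a b (by rw [hm4]; exact a.2) (by rw [hm4]; exact b.2) hab)
  have hpmem : ∀ k : Fin 4, p k ∈ tightSet X c := fun k =>
    facetVertex_mem hc (by rw [← hm, hm4]; exact k.2)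
  have hpsurj : ∀ y ∈ tightSet X c, ∃ k : Fin 4, y = p k := by
    intro y hy
    obtain ⟨i, hi, hwy⟩ := exists_facetVertex_eq hX1 hc hy
    rw [← hm, hm4] at hi
    exact ⟨⟨i, hi⟩, hwy.symm⟩
  have hlt : ∀ k : Fin 4, (k : ℕ) < m := fun k => by rw [hm4]; exact k.2
  have hne : ∀ {a b : ℕ}, a < 4 → b < 4 → a ≠ b → w a ≠ w b := by
    intro a b ha hb hab h
    exact hab (hinj a b (by rw [hm4]; exact ha) (by rw [hm4]; exact hb) h)
  -- the sides are the consecutive pairs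
  have hE : edgesOfFacet X c = {{w 0, w 1}, {w 1, w 2}, {w 2, w 3}, {w 3, w 0}} := by
    rw [edgesOfFacet_eq_image hX1 h0 hcF]
    change (Finset.range m).image (fun j => ({w j, w ((j + 1) % m)} : Finset _)) = _
    have hr : Finset.range 4 = {0, 1, 2, 3} := by decide
    rw [hm4, hr, Finset.image_insert, Finset.image_insert, Finset.image_insert,
      Finset.image_singleton]
  -- a diagonal is not a hull edge: it would be a fifth side
  have hdiag : ∀ {a b : ℕ}, a < 4 → b < 4 →
      (∀ S ∈ ({{w 0, w 1}, {w 1, w 2}, {w 2, w 3}, {w 3, w 0}} :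
        Finset (Finset (EuclideanSpace ℝ (Fin 3)))), ({w a, w b} : Finset _) ≠ S) →
      ({w a, w b} : Finset (EuclideanSpace ℝ (Fin 3))) ∉ hullEdges X := by
    intro a b ha hb hS hH
    have hsub : ({w a, w b} : Finset (EuclideanSpace ℝ (Fin 3))) ⊆ tightSet X c := by
      intro y hy
      rw [Finset.mem_insert, Finset.mem_singleton] at hy
      rcases hy with rfl | rfl
      · exact facetVertex_mem hc (by rw [← hm, hm4]; exact ha)
      · exact facetVertex_mem hc (by rw [← hm, hm4]; exact hb)
    have hmem : ({w a, w b} : Finset (EuclideanSpace ℝ (Fin 3))) ∈ edgesOfFacet X c := by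
      unfold edgesOfFacet
      exact Finset.mem_filter.2 ⟨hH, hsub⟩
    rw [hE] at hmem
    exact hS _ hmem rfl
  -- membership helper: `{x, y} = {u, u'}` puts `x` and `y` in `{u, u'}`
  have hpair : ∀ {x y u u' : EuclideanSpace ℝ (Fin 3)},
      ({x, y} : Finset (EuclideanSpace ℝ (Fin 3))) = {u, u'} →
        (x = u ∨ x = u') ∧ (y = u ∨ y = u') := by
    intro x y u u' h
    have hx : x ∈ ({u, u'} : Finset (EuclideanSpace ℝ (Fin 3))) := by
      rw [← h]; exact Finset.mem_insert_self _ _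
    have hy : y ∈ ({u, u'} : Finset (EuclideanSpace ℝ (Fin 3))) := by
      rw [← h]; exact Finset.mem_insert_of_mem (Finset.mem_singleton_self _)
    rw [Finset.mem_insert, Finset.mem_singleton] at hx hy
    exact ⟨hx, hy⟩
  have h02 : ({w 0, w 2} : Finset (EuclideanSpace ℝ (Fin 3))) ∉ hullEdges X := by
    refine hdiag (by norm_num) (by norm_num) fun S hS hSe => ?_
    simp only [Finset.mem_insert, Finset.mem_singleton] at hS
    rcases hS with rfl | rfl | rfl | rfl
    · rcases (hpair hSe).2 with h | h
      · exact hne (by norm_num) (by norm_num) (by norm_num) h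
      · exact hne (by norm_num) (by norm_num) (by norm_num) h
    · rcases (hpair hSe).1 with h | h
      · exact hne (by norm_num) (by norm_num) (by norm_num) h
      · exact hne (by norm_num) (by norm_num) (by norm_num) h
    · rcases (hpair hSe).1 with h | h
      · exact hne (by norm_num) (by norm_num) (by norm_num) h
      · exact hne (by norm_num) (by norm_num) (by norm_num) h
    · rcases (hpair hSe).2 with h | h
      · exact hne (by norm_num) (by norm_num) (by norm_num) h
      · exact hne (by norm_num) (by norm_num) (by norm_num) h
  have h13 : ({w 1, w 3} : Finset (EuclideanSpace ℝ (Fin 3))) ∉ hullEdges X := by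
    refine hdiag (by norm_num) (by norm_num) fun S hS hSe => ?_
    simp only [Finset.mem_insert, Finset.mem_singleton] at hS
    rcases hS with rfl | rfl | rfl | rfl
    · rcases (hpair hSe).2 with h | h
      · exact hne (by norm_num) (by norm_num) (by norm_num) h
      · exact hne (by norm_num) (by norm_num) (by norm_num) h
    · rcases (hpair hSe).2 with h | h
      · exact hne (by norm_num) (by norm_num) (by norm_num) h
      · exact hne (by norm_num) (by norm_num) (by norm_num) h
    · rcases (hpair hSe).1 with h | h
      · exact hne (by norm_num) (by norm_num) (by norm_num) h
      · exact hne (by norm_num) (by norm_num) (by norm_num) h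
    · rcases (hpair hSe).1 with h | h
      · exact hne (by norm_num) (by norm_num) (by norm_num) h
      · exact hne (by norm_num) (by norm_num) (by norm_num) h
  exact ⟨p, hpinj, hpmem, hpsurj, hE, h02, h13⟩

end Summit.AtomisticToContinuum.Crystallization.Theorems
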